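import Mathlib
import HarnessLib
import Summits.MatrixMultiplication.MatrixMultiplication.Theorems.OutsiderSandwichToricCeilingPow

/-!
# OutsiderSandwich — complements of large toric diagonals of `cw₂^{⊠N}`: the letter-count law
(decomp-mm lens 4, gen 44, kernel K44-1; THESES-FREE, `ω`-free; helper toward `LaserTangency`,
stmt-32268 — the extremal subrank/packing cells of the literal host `kroneckerPow (cwTensor ℂ 2) N`)

WHAT.  Part 2 (`…ToricCeilingPow`) proved the toric ceiling `#Ψ ≤ 3^N - 2` (`N ≥ 2`, every product
basis `κ`) by pinning the complement of a putative `⟨3^N - 1⟩` to a STAR (`count_identity`,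
`star_dslot`: one missing word per leg).  This file is the COMPLEMENT LAW FOR EVERY CO-SIZE `k`:
if a leg-injective `Ψ ⊆ frame κ` misses exactly the word sets `X, Y, Z` on legs A, B, C, then

* `card_add_missing`: `#Ψ + #X = #Ψ + #Y = #Ψ + #Z = 3^N` (the legs miss equally many words, `k`);
* `count_identity_sdiff`: for every coordinate `i` and letter `α`,
  `Σ_{t ∈ Ψ} cntᵢ(α, t) + mᵢ^X(α) + mᵢ^Y(α) + mᵢ^Z(α) = 3^N`, where
  `mᵢ^S(α) = #{p ∈ S | pᵢ = α}` counts the letter `α` at coordinate `i` in `S`;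
* `missing_letters_dcoord`: at a PERMUTATION coordinate (`κ i = false`) every letter `α` occurs
  exactly `k` times among the `3k` missing letters: `mᵢ^X(α) + mᵢ^Y(α) + mᵢ^Z(α) = k`;
* `missing_letters_cwcoord`: at a COPPERSMITH–WINOGRAD coordinate (`κ i = true`) the letter `0`
  occurs exactly `k` times and each of the letters `1, 2` an ODD number of times;
* `image_eq_sdiff_pair`, `two_missing_letters_dcoord`, `two_missing_letters_cwcoord`: the case
  `#Ψ = 3^N - 2` spelled out on six missing words `x₁ ≠ x₂`, `y₁ ≠ y₂`, `z₁ ≠ z₂` — at a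
  permutation coordinate each letter occurs exactly twice among `x₁ᵢ, x₂ᵢ, y₁ᵢ, y₂ᵢ, z₁ᵢ, z₂ᵢ`, at a
  cw coordinate `0` twice and `1, 2` once or three times.

WHY (programme use).  These are exactly the ADMISSIBILITY CONSTRAINTS under which the `N = 3`
toric censuses of the decomposition cell enumerate complements (sizes `25, 24, 23`: no toric
diagonal found in any product basis; memo NODE-g43/NODE-g44 of decomp-mm lens 4): the census
hypothesis "missing configurations restricted by the count identity" is hereby a theorem for every
`N`, every `κ` and every `k`, so a census over admissible complements is a census over ALL
complements.  They are also the first step of any attack on the all-`N` sharpening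
`#Ψ ≤ 3^N - 3` (tight frame, `N ≥ 2`; open — see the memo for the perfect-matching reformulation
and the `2`-adic evidence).

THE ARGUMENT.  Pure counting: a triple of the frame hits the letter `α` at coordinate `i` exactly
once on its three legs at a permutation coordinate (resp. `0` once, `1, 2` an even number of times
at a cw coordinate: `slot_cnt`), while the words with letter `α` at `i` number `3^(N-1)` per leg
(`card_coord_fibre`); summing over `Ψ` and adding the missing words gives the identities, and
`3^N` odd gives the parities.  No weights, no `Farkas`: the law constrains every leg-injective
`Ψ` of co-size `k`, toric or not.
-/

set_option linter.dupNamespace false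

namespace Summit.MatrixMultiplication.MatrixMultiplication.Theorems.OutsiderSandwichToricComplement

open Finset
open Summit.MatrixMultiplication.MatrixMultiplication.Theorems.OutsiderSandwichToricCeiling
  (cwSlot dSlot)
open Summit.MatrixMultiplication.MatrixMultiplication.Theorems.OutsiderSandwichToricCeilingPowFibres
open Summit.MatrixMultiplication.MatrixMultiplication.Theorems.OutsiderSandwichToricCeilingPow
  (card_coord_fibre sum_ite_eq_card_image)

variable {N : ℕ}

/-! ## §1 Letter counts of a word set and the general count identity -/

/-- Removing a word set lowers a coordinate fibre by its letter count. [folklore] -/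
theorem card_sdiff_coord_fibre (i : Fin N) (α : Fin 3) (S : Finset (Word N)) :
    #{p ∈ univ \ S | p i = α} + #{p ∈ S | p i = α} = 3 ^ (N - 1) := by
  rw [← card_coord_fibre i α]
  have h : {p ∈ univ \ S | p i = α} =
      {p ∈ (univ : Finset (Word N)) | p i = α} \ {p ∈ S | p i = α} := by
    ext p
    simp only [Finset.mem_filter, Finset.mem_sdiff, Finset.mem_univ, true_and, not_and]
    tauto
  rw [h]
  exact Finset.card_sdiff_add_card_eq_card (fun p hp => by
    simp only [Finset.mem_filter, Finset.mem_univ, true_and] at hp ⊢; exact hp.2)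

/-- The three letter counts of a word set add up to its size. [folklore] -/
theorem mcnt_sum (S : Finset (Word N)) (i : Fin N) :
    #{p ∈ S | p i = 0} + #{p ∈ S | p i = 1} + #{p ∈ S | p i = 2} = #S := by
  simp only [Finset.card_filter, ← Finset.sum_add_distrib]
  rw [Finset.card_eq_sum_ones]
  exact Finset.sum_congr rfl fun p _ => ind_sum (p i)

/-- LEGS MISS EQUALLY MANY WORDS: if the leg `g` is injective on `Ψ` with image `univ ∖ X`, then
`#Ψ + #X = 3^N`. [new] -/
theorem card_add_missing {Ψ : Finset (Tr3 N)} {g : Tr3 N → Word N} (hg : Set.InjOn g Ψ)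
    {X : Finset (Word N)} (iX : Ψ.image g = univ \ X) : #Ψ + #X = 3 ^ N := by
  have hW : Fintype.card (Word N) = 3 ^ N := by simp
  have h := Finset.card_image_of_injOn hg
  rw [iX, Finset.card_univ_sdiff, hW] at h
  have hX : #X ≤ 3 ^ N := hW ▸ Finset.card_le_univ X
  omega

/-- THE COUNT IDENTITY for an arbitrary complement: for a leg-injective `Ψ` missing exactly the
word sets `X, Y, Z` on the three legs, `Σ_{t ∈ Ψ} cntᵢ(α, t) + mᵢ^X(α) + mᵢ^Y(α) + mᵢ^Z(α) = 3^N`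
for every coordinate `i` and letter `α`. [new] -/
theorem count_identity_sdiff {Ψ : Finset (Tr3 N)} (j₁ : Set.InjOn (fun t : Tr3 N => t.1) Ψ)
    (j₂ : Set.InjOn (fun t : Tr3 N => t.2.1) Ψ) (j₃ : Set.InjOn (fun t : Tr3 N => t.2.2) Ψ)
    {X Y Z : Finset (Word N)} (i₁ : Ψ.image (fun t : Tr3 N => t.1) = univ \ X)
    (i₂ : Ψ.image (fun t : Tr3 N => t.2.1) = univ \ Y)
    (i₃ : Ψ.image (fun t : Tr3 N => t.2.2) = univ \ Z) (i : Fin N) (α : Fin 3) :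
    (∑ t ∈ Ψ, cnt i α t) + (#{p ∈ X | p i = α} + #{p ∈ Y | p i = α} + #{p ∈ Z | p i = α}) =
      3 * 3 ^ (N - 1) := by
  have ex := card_sdiff_coord_fibre i α X
  have ey := card_sdiff_coord_fibre i α Y
  have ez := card_sdiff_coord_fibre i α Z
  simp only [cnt, Finset.sum_add_distrib]
  rw [sum_ite_eq_card_image j₁ (fun p => p i = α), sum_ite_eq_card_image j₂ (fun p => p i = α),
    sum_ite_eq_card_image j₃ (fun p => p i = α), i₁, i₂, i₃]
  omega

/-! ## §2 The letter-count law of the complement (every `N`, every product basis, every `k`) -/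

/-- **PERMUTATION COORDINATE.**  If `Ψ ⊆ frame κ` is leg-injective and misses exactly `X, Y, Z`,
then at a coordinate written in the permutation basis every letter occurs exactly `k = #X` times
among the missing letters: `mᵢ^X(α) + mᵢ^Y(α) + mᵢ^Z(α) = #X`. [new] -/
theorem missing_letters_dcoord (κ : Fin N → Bool) {Ψ : Finset (Tr3 N)} (hsub : Ψ ⊆ frame κ)
    (j₁ : Set.InjOn (fun t : Tr3 N => t.1) Ψ) (j₂ : Set.InjOn (fun t : Tr3 N => t.2.1) Ψ)
    (j₃ : Set.InjOn (fun t : Tr3 N => t.2.2) Ψ) {X Y Z : Finset (Word N)}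
    (i₁ : Ψ.image (fun t : Tr3 N => t.1) = univ \ X)
    (i₂ : Ψ.image (fun t : Tr3 N => t.2.1) = univ \ Y)
    (i₃ : Ψ.image (fun t : Tr3 N => t.2.2) = univ \ Z) (i : Fin N) (hκ : κ i = false)
    (α : Fin 3) : #{p ∈ X | p i = α} + #{p ∈ Y | p i = α} + #{p ∈ Z | p i = α} = #X := by
  have total : 3 * 3 ^ (N - 1) = 3 ^ N := by
    rw [← pow_succ', Nat.sub_add_cancel (Fin.pos i)]
  have CI := count_identity_sdiff j₁ j₂ j₃ i₁ i₂ i₃ i α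
  have slot : ∀ t ∈ Ψ, slotB (κ i) (t.1 i) (t.2.1 i) (t.2.2 i) = true := fun t ht =>
    (Finset.mem_filter.mp (hsub ht)).2 i
  have h1 : ∀ t ∈ Ψ, cnt i α t = 1 := fun t ht => (slot_cnt (κ i) _ _ _ (slot t ht) α).1 (Or.inr hκ)
  have hs : ∑ t ∈ Ψ, cnt i α t = #Ψ := by
    rw [Finset.sum_congr rfl h1, Finset.sum_const, smul_eq_mul, mul_one]
  have cm := card_add_missing j₁ i₁
  omega

/-- **COPPERSMITH–WINOGRAD COORDINATE.**  At a coordinate written in the cw basis the letter `0`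
occurs exactly `k = #X` times among the missing letters and each of `1, 2` an odd number of times
(`3^N` is odd and every frame triple carries `1` and `2` an even number of times there). [new] -/
theorem missing_letters_cwcoord (κ : Fin N → Bool) {Ψ : Finset (Tr3 N)} (hsub : Ψ ⊆ frame κ)
    (j₁ : Set.InjOn (fun t : Tr3 N => t.1) Ψ) (j₂ : Set.InjOn (fun t : Tr3 N => t.2.1) Ψ)
    (j₃ : Set.InjOn (fun t : Tr3 N => t.2.2) Ψ) {X Y Z : Finset (Word N)}
    (i₁ : Ψ.image (fun t : Tr3 N => t.1) = univ \ X)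
    (i₂ : Ψ.image (fun t : Tr3 N => t.2.1) = univ \ Y)
    (i₃ : Ψ.image (fun t : Tr3 N => t.2.2) = univ \ Z) (i : Fin N) (hκ : κ i = true) :
    #{p ∈ X | p i = 0} + #{p ∈ Y | p i = 0} + #{p ∈ Z | p i = 0} = #X ∧
      Odd (#{p ∈ X | p i = 1} + #{p ∈ Y | p i = 1} + #{p ∈ Z | p i = 1}) ∧
      Odd (#{p ∈ X | p i = 2} + #{p ∈ Y | p i = 2} + #{p ∈ Z | p i = 2}) := by
  have total : 3 * 3 ^ (N - 1) = 3 ^ N := by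
    rw [← pow_succ', Nat.sub_add_cancel (Fin.pos i)]
  have CI := fun α => count_identity_sdiff j₁ j₂ j₃ i₁ i₂ i₃ i α
  have slot : ∀ t ∈ Ψ, slotB (κ i) (t.1 i) (t.2.1 i) (t.2.2 i) = true := fun t ht =>
    (Finset.mem_filter.mp (hsub ht)).2 i
  have cm := card_add_missing j₁ i₁
  refine ⟨?_, ?_, ?_⟩
  · have h1 : ∀ t ∈ Ψ, cnt i 0 t = 1 := fun t ht =>
      (slot_cnt (κ i) _ _ _ (slot t ht) 0).1 (Or.inl rfl)
    have hs : ∑ t ∈ Ψ, cnt i 0 t = #Ψ := by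
      rw [Finset.sum_congr rfl h1, Finset.sum_const, smul_eq_mul, mul_one]
    have := CI 0
    omega
  all_goals
    have h3 : Odd (3 ^ N) := Odd.pow (by decide)
  · have hev : Even (∑ t ∈ Ψ, cnt i 1 t) :=
      Finset.even_sum _ fun t ht => (slot_cnt (κ i) _ _ _ (slot t ht) 1).2 hκ (by decide)
    have := CI 1
    rw [total] at this
    rw [← this, Nat.odd_add] at h3
    exact Nat.not_even_iff_odd.mp fun hm => (Nat.not_even_iff_odd.mpr (h3.mpr hm)) hev
  · have hev : Even (∑ t ∈ Ψ, cnt i 2 t) :=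
      Finset.even_sum _ fun t ht => (slot_cnt (κ i) _ _ _ (slot t ht) 2).2 hκ (by decide)
    have := CI 2
    rw [total] at this
    rw [← this, Nat.odd_add] at h3
    exact Nat.not_even_iff_odd.mp fun hm => (Nat.not_even_iff_odd.mpr (h3.mpr hm)) hev

/-- The legs of such a `Ψ` miss equally many words. [new] -/
theorem card_missing_eq {Ψ : Finset (Tr3 N)} (j₁ : Set.InjOn (fun t : Tr3 N => t.1) Ψ)
    (j₂ : Set.InjOn (fun t : Tr3 N => t.2.1) Ψ) (j₃ : Set.InjOn (fun t : Tr3 N => t.2.2) Ψ)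
    {X Y Z : Finset (Word N)} (i₁ : Ψ.image (fun t : Tr3 N => t.1) = univ \ X)
    (i₂ : Ψ.image (fun t : Tr3 N => t.2.1) = univ \ Y)
    (i₃ : Ψ.image (fun t : Tr3 N => t.2.2) = univ \ Z) : #Y = #X ∧ #Z = #X := by
  have := card_add_missing j₁ i₁
  have := card_add_missing j₂ i₂
  have := card_add_missing j₃ i₃
  omega

/-! ## §3 Co-size two: six missing words -/

/-- A leg-injective `Ψ` with `#Ψ + 2 = 3^N` misses exactly two (distinct) words on each leg.
[new] -/
theorem image_eq_sdiff_pair {Ψ : Finset (Tr3 N)} {g : Tr3 N → Word N} (hg : Set.InjOn g Ψ)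
    (hcard : #Ψ + 2 = 3 ^ N) : ∃ x₁ x₂ : Word N, x₁ ≠ x₂ ∧ Ψ.image g = univ \ {x₁, x₂} := by
  have hW : Fintype.card (Word N) = 3 ^ N := by simp
  have h2 : #(univ \ Ψ.image g) = 2 := by
    rw [Finset.card_univ_sdiff, Finset.card_image_of_injOn hg, hW]; omega
  obtain ⟨x₁, x₂, hne, hx⟩ := Finset.card_eq_two.mp h2
  exact ⟨x₁, x₂, hne, by rw [← hx, Finset.sdiff_sdiff_eq_self (Finset.subset_univ _)]⟩

/-- Letter count of a pair of distinct words. [folklore] -/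
theorem mcnt_pair {x₁ x₂ : Word N} (h : x₁ ≠ x₂) (i : Fin N) (α : Fin 3) :
    #{p ∈ {x₁, x₂} | p i = α} = (if x₁ i = α then 1 else 0) + (if x₂ i = α then 1 else 0) := by
  rw [Finset.filter_insert, Finset.filter_singleton]
  by_cases h₁ : x₁ i = α <;> by_cases h₂ : x₂ i = α <;> simp [h₁, h₂, h]

/-- **SIX MISSING WORDS, PERMUTATION COORDINATE.**  If a leg-injective `Ψ ⊆ frame κ` misses
exactly `x₁ ≠ x₂` on leg A, `y₁ ≠ y₂` on leg B and `z₁ ≠ z₂` on leg C, then at every coordinate in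
the permutation basis each letter occurs exactly TWICE among the six missing letters. [new] -/
theorem two_missing_letters_dcoord (κ : Fin N → Bool) {Ψ : Finset (Tr3 N)} (hsub : Ψ ⊆ frame κ)
    (j₁ : Set.InjOn (fun t : Tr3 N => t.1) Ψ) (j₂ : Set.InjOn (fun t : Tr3 N => t.2.1) Ψ)
    (j₃ : Set.InjOn (fun t : Tr3 N => t.2.2) Ψ) {x₁ x₂ y₁ y₂ z₁ z₂ : Word N} (hx : x₁ ≠ x₂)
    (hy : y₁ ≠ y₂) (hz : z₁ ≠ z₂) (i₁ : Ψ.image (fun t : Tr3 N => t.1) = univ \ {x₁, x₂})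
    (i₂ : Ψ.image (fun t : Tr3 N => t.2.1) = univ \ {y₁, y₂})
    (i₃ : Ψ.image (fun t : Tr3 N => t.2.2) = univ \ {z₁, z₂}) (i : Fin N) (hκ : κ i = false)
    (α : Fin 3) :
    (if x₁ i = α then 1 else 0) + (if x₂ i = α then 1 else 0) + ((if y₁ i = α then 1 else 0) +
      (if y₂ i = α then 1 else 0)) + ((if z₁ i = α then 1 else 0) + (if z₂ i = α then 1 else 0))
      = 2 := by
  have h := missing_letters_dcoord κ hsub j₁ j₂ j₃ i₁ i₂ i₃ i hκ α
  rw [mcnt_pair hx, mcnt_pair hy, mcnt_pair hz, Finset.card_pair hx] at h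
  exact h

/-- **SIX MISSING WORDS, CW COORDINATE.**  Same hypotheses; at a coordinate in the cw basis the
letter `0` occurs exactly twice among the six missing letters and each of `1, 2` an odd number of
times (hence once or three times). [new] -/
theorem two_missing_letters_cwcoord (κ : Fin N → Bool) {Ψ : Finset (Tr3 N)} (hsub : Ψ ⊆ frame κ)
    (j₁ : Set.InjOn (fun t : Tr3 N => t.1) Ψ) (j₂ : Set.InjOn (fun t : Tr3 N => t.2.1) Ψ)
    (j₃ : Set.InjOn (fun t : Tr3 N => t.2.2) Ψ) {x₁ x₂ y₁ y₂ z₁ z₂ : Word N} (hx : x₁ ≠ x₂)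
    (hy : y₁ ≠ y₂) (hz : z₁ ≠ z₂) (i₁ : Ψ.image (fun t : Tr3 N => t.1) = univ \ {x₁, x₂})
    (i₂ : Ψ.image (fun t : Tr3 N => t.2.1) = univ \ {y₁, y₂})
    (i₃ : Ψ.image (fun t : Tr3 N => t.2.2) = univ \ {z₁, z₂}) (i : Fin N) (hκ : κ i = true) :
    (if x₁ i = 0 then 1 else 0) + (if x₂ i = 0 then 1 else 0) + ((if y₁ i = 0 then 1 else 0) +
      (if y₂ i = 0 then 1 else 0)) + ((if z₁ i = 0 then 1 else 0) + (if z₂ i = 0 then 1 else 0))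
      = 2 ∧
    Odd ((if x₁ i = 1 then 1 else 0) + (if x₂ i = 1 then 1 else 0) + ((if y₁ i = 1 then 1 else 0) +
      (if y₂ i = 1 then 1 else 0)) + ((if z₁ i = 1 then 1 else 0) + (if z₂ i = 1 then 1 else 0))) ∧
    Odd ((if x₁ i = 2 then 1 else 0) + (if x₂ i = 2 then 1 else 0) + ((if y₁ i = 2 then 1 else 0) +
      (if y₂ i = 2 then 1 else 0)) +
      ((if z₁ i = 2 then 1 else 0) + (if z₂ i = 2 then 1 else 0))) := by
  have h := missing_letters_cwcoord κ hsub j₁ j₂ j₃ i₁ i₂ i₃ i hκ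
  simp only [mcnt_pair hx, mcnt_pair hy, mcnt_pair hz, Finset.card_pair hx] at h
  exact h

/-- THE TIGHT FRAME (`κ ≡ false`, every coordinate in the permutation basis), size `3^N - 2`:
the complement of any leg-injective `Ψ ⊆ frame (fun _ => false)` with `#Ψ + 2 = 3^N` consists of
six words `x₁ ≠ x₂, y₁ ≠ y₂, z₁ ≠ z₂` carrying every letter exactly twice at every coordinate — the
enumeration hypothesis of the `N = 3` census (no toric `⟨25⟩` in `D^{⊠3}`). [new] -/
theorem tightFrame_two_missing_law {Ψ : Finset (Tr3 N)} (hsub : Ψ ⊆ frame (fun _ : Fin N => false))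
    (hdiag : ∀ t ∈ Ψ, ∀ t' ∈ Ψ, (t.1 = t'.1 ∨ t.2.1 = t'.2.1 ∨ t.2.2 = t'.2.2) → t = t')
    (hcard : #Ψ + 2 = 3 ^ N) :
    ∃ x₁ x₂ y₁ y₂ z₁ z₂ : Word N, x₁ ≠ x₂ ∧ y₁ ≠ y₂ ∧ z₁ ≠ z₂ ∧
      Ψ.image (fun t : Tr3 N => t.1) = univ \ {x₁, x₂} ∧
      Ψ.image (fun t : Tr3 N => t.2.1) = univ \ {y₁, y₂} ∧
      Ψ.image (fun t : Tr3 N => t.2.2) = univ \ {z₁, z₂} ∧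
      ∀ (i : Fin N) (α : Fin 3),
        (if x₁ i = α then 1 else 0) + (if x₂ i = α then 1 else 0) + ((if y₁ i = α then 1 else 0) +
          (if y₂ i = α then 1 else 0)) + ((if z₁ i = α then 1 else 0) + (if z₂ i = α then 1 else 0))
          = 2 := by
  have j₁ : Set.InjOn (fun t : Tr3 N => t.1) Ψ := fun t ht t' ht' e => hdiag t ht t' ht' (Or.inl e)
  have j₂ : Set.InjOn (fun t : Tr3 N => t.2.1) Ψ :=
    fun t ht t' ht' e => hdiag t ht t' ht' (Or.inr (Or.inl e))
  have j₃ : Set.InjOn (fun t : Tr3 N => t.2.2) Ψ :=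
    fun t ht t' ht' e => hdiag t ht t' ht' (Or.inr (Or.inr e))
  obtain ⟨x₁, x₂, hx, i₁⟩ := image_eq_sdiff_pair j₁ hcard
  obtain ⟨y₁, y₂, hy, i₂⟩ := image_eq_sdiff_pair j₂ hcard
  obtain ⟨z₁, z₂, hz, i₃⟩ := image_eq_sdiff_pair j₃ hcard
  exact ⟨x₁, x₂, y₁, y₂, z₁, z₂, hx, hy, hz, i₁, i₂, i₃, fun i α =>
    two_missing_letters_dcoord (fun _ => false) hsub j₁ j₂ j₃ hx hy hz i₁ i₂ i₃ i rfl α⟩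

end Summit.MatrixMultiplication.MatrixMultiplication.Theorems.OutsiderSandwichToricComplement
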